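import Summits.QuantumFields.BalabanUV.Beta.GAN24.StripLegUnitsJMRatio
import Summits.QuantumFields.BalabanUV.Beta.GAN24.KSlotJMHolds

/-!
# `BalabanUV.Beta.GAN24.KPerfTailAmplitude` — binder row G-an2-4 ∕ (CONV-C), lineage gan24-p3 (part P3, Woodbury ∕ fibre layer):
# **THE PERFECT ONE-STEP RESOLVENT AT BASE `n = Lc^m` DECAYS LIKE `C₀·n⁶·e^{−(δ₀∕n)|x′−y′|₁}` — `δ₀`, `C₀` FREE OF `m`** (the exponential-in-`n` amplitude of
# `GAN24/KPerfTailRate` replaced by a POLYNOMIAL one, via the ratio-sharp (U2) of `GAN24/StripLegUnitsJMRatio`)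

NOT IN PRINT; OUR PROOF (bookkeeping over tree theorems BY NAME).  HONEST FRAMING (cell contract, verbatim): «discharging `BetaPertH` makes Bałaban's UV stability
UNCONDITIONAL — a real constructive-QFT result; it is NOT the continuum limit and NOT the Clay problem.»  HONEST DEPENDENCY (verbatim): «continuum YM on T⁴ ⇐ BetaPertH ∧ nine
spine estimates (0/9 proved); BetaPertH ⇐ (D1) ∧ (D4) ∧ CAP+tail; G-an2-4 gates asym, D1 and NE2/3/4.»

CONTENT (`d = 3`; [our object] ∕ [folklore] ∕ [our proof]):
* §1 `envOutR`, `cstUR` — the (U2) constant of road P1's (I3′) with `StripLegUnitsJMRatio.cstSqR` (no exponential in the relative blocking); `legBound_jm_of_inv_bound_ratio`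
  (`FibreStripJMHolds.legBound_jm_of_inv_bound` with `cstSqR`).
* §2 **`stripRegularKM_uniform_poly : ∃ κ, 0 < κ ∧ κ ≤ 1∕4 ∧ ∃ ρ₀ > 0, ∀ m, StripRegularKM 3 Lc m κ (cstUR (ArrowAnchorReal.aR 4) κ (Lc^m) ρ₀)`** (every `Lc ≥ 1`) —
  `KPerfTailRate.stripRegularKM_uniform` re-run with the polynomial constant.
* §3 `polySq`∕`polyOut`∕`KU` and **`cstUR_le_KU_mul_pow : 1 ≤ R → cstUR aR κ R ρ₀ ≤ KU aR κ ρ₀ · R⁶`** (`cstSqR ≤ polySq·R¹²` since `R⁻² ≤ R¹²`, `R⁻¹⁶ ≤ R¹²`).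
* §4 **`decays_KPerf_polyAmplitude` (`2 ≤ Lc`): `∃ δ₀ C₀, 0 < δ₀ ∧ 0 ≤ C₀ ∧ ∀ m ≥ 1, Decays (KPerf Lc (sfStep Lc) (smStep 3 Lc) m) (C₀·((Lc:ℝ)^m)^6) (δ₀ ∕ (Lc:ℝ)^m)`** and the bare
  (j, m)-family form `decays_KTot_polyAmplitude` (every `Lc ≥ 1`, every `m`, uniform in `j`).
WHAT THIS IS NOT: the END's tail AMPLITUDE for road FP's N7c is `R′∕(r+1)^a` (a DECAYING power on the window scale); `C₀·n⁶` is a GROWING polynomial — the bound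
`C₀ n⁶ e^{−δ₀|w|∕n}` is informative only for `|w| ≳ (6∕δ₀)·n·log n`, i.e. beyond the window up to a logarithm; the window profile itself (rows N7b ∕ GERM-K) is untouched.
0 wall binders instantiated; NEVER «G-an2-4 closed», NOT (CONV-C) for G_k∕H_k, NOT N7c, NOT D1, NOT BetaPertH, NOT continuum, NOT Clay.

ABSOLUTE RULE (cell, verbatim): «No internally-minted statement may enter as a cited fact. Every hypothesis is either kernel-proved in this package or a
verbatim quotation of a PUBLISHED theorem with page reference.»  Nothing is cited; five data `def`s (explicit real constants); every input is a tree theorem imported BY NAME.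
-/

noncomputable section

open Matrix Complex Finset
open scoped Matrix.Norms.L2Operator Real BigOperators
open Literature.MathematicalPhysics.QuantumFieldTheory
open Literature.MathematicalPhysics.QuantumFieldTheory.Balaban1983to89
open Literature.MathematicalPhysics.QuantumFieldTheory.Balaban1983to89.Beta
open Literature.MathematicalPhysics.QuantumFieldTheory.LatticeForm (quo repZ)
open Literature.Probability.LatticeModels (TorusSite)
open B4Strip (Strip reVec ofRealVec)
open B4ContourShift (BZ)
open BlochFibreMatrix (stencil pieceMatrix)
open FibreInverseDecay (trigPolySymbol reVec_mem_BZ)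
open ExpKernelCalculus (Decays)
open OneStepResolventKernel (Fib decays_mono)
open Summit.QuantumFields.BalabanUV.Beta.HessKerDressedUnits (unitK)
open Summit.QuantumFields.BalabanUV.Beta.GAN24.CombesThomas (sfStep smStep UniformDecays)
open Summit.QuantumFields.BalabanUV.Beta.GAN24.CombesThomasFibreStep (kFibW)
open Summit.QuantumFields.BalabanUV.Beta.GAN24.ArrowOperator
open Summit.QuantumFields.BalabanUV.Beta.GAN24.ArrowScaling
open Summit.QuantumFields.BalabanUV.Beta.GAN24.ArrowAnchorZero (isUnit_innerArrow_zero)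
open Summit.QuantumFields.BalabanUV.Beta.GAN24.FibreDetStripOfAnchors (exists_radii)
open Summit.QuantumFields.BalabanUV.Beta.GAN24.FibreDetStrip (apriori_of_rows det_ne_zero_of_rows abs_le_pi_of_mem_BZ)
open Summit.QuantumFields.BalabanUV.Beta.GAN24.FibreStripOfRows (sigR rhoR sigR_pos sigR_A sigR_phi rhoR_EL rhoR_Q apriori_sq_of_inv_bound radI_hyps radO_hyps
  radO_zero_le le_radO_zero)
open Summit.QuantumFields.BalabanUV.Beta.GAN24.FibreStrip (omegaOut OmegaOut omegaOut_le OmegaOut_nonneg cOut4 cOut4_nonneg)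
open Summit.QuantumFields.BalabanUV.Beta.GAN24.FibreStripJM (kFibΔM StripRegularKM kFibΔM_repZ_eq_kFibW stripRegularKM_of_repZ stripRegular_kFibΔM
  uniformDecays_of_stripRegularKM cst_nonneg_of_stripRegularKM)
open Summit.QuantumFields.BalabanUV.Beta.GAN24.FibreStripJMHolds (one_le_pow_add)
open Summit.QuantumFields.BalabanUV.Beta.GAN24.StripLegUnitsJMRatio (cstSqR cstSqR_nonneg cstSqR_mono norm_kFibW_jm_le_sqrt_cstSqR)
open Summit.QuantumFields.BalabanUV.Beta.GAN24.KSlotJMHolds (decays_KPerf_explicit)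
open Summit.QuantumFields.BalabanUV.Beta.FP.PerfectObjects (KTot)
open Summit.QuantumFields.BalabanUV.Beta.FP.PerfectObjectsT (KPerf)

namespace Summit.QuantumFields.BalabanUV.Beta.GAN24.KPerfTailAmplitude

/-! ## §1 The (U2) constant without the exponential; the leg bound at one strip point -/

section Constants

/-- [our object] The OUTER ENVELOPE of `cstSqR` at `A = 2·aR`, zero-alias radius range `[ρ₀∕π, 2π]` (`cstSqR_mono`) — `FibreStripOfRows.envOut` without the exponential. -/
def envOutR (aR κ : ℝ) (R : ℕ) (ρ₀ : ℝ) : ℝ :=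
  (2 * aR) ^ 2 * (Real.exp (κ * 4) ^ 4 * ((6 : ℝ) ^ 10 * (5 : ℝ) ^ 4 * (R : ℝ) ^ 12) * ((ρ₀ / π)⁻¹ ^ 4 + 39)
    + Real.exp (κ * 4) ^ 2 * ((6 : ℝ) ^ 5 * (5 : ℝ) ^ 4) * ((R : ℝ) ^ 2)⁻¹
    + Real.exp (κ * 4) ^ 2 * (6 : ℝ) ^ 5 * (1 + 39 * (2 * π) ^ 4) * ((R : ℝ) ^ 2)⁻¹
    + (2 * π) ^ 4 * ((R : ℝ) ^ 16)⁻¹)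

/-- [our object] THE POLYNOMIAL UNIFORM CONSTANT of (U2): inner contribution `√(cstSqR 5 κ R 1)` ⊔ outer envelope `√(envOutR aR κ R ρ₀)` — `FibreStripOfRows.cstU` without the
exponential in `R`. -/
def cstUR (aR κ : ℝ) (R : ℕ) (ρ₀ : ℝ) : ℝ := max (Real.sqrt (cstSqR (2 * (5 / 2)) κ R 1)) (Real.sqrt (envOutR aR κ R ρ₀))

/-- [folklore] `0 ≤ cstUR`. -/
theorem cstUR_nonneg (aR κ : ℝ) (R : ℕ) (ρ₀ : ℝ) : 0 ≤ cstUR aR κ R ρ₀ := le_max_of_le_left (Real.sqrt_nonneg _)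

end Constants

section LegBound

variable {Lc : ℕ} [NeZero Lc]

/-- [folklore] **(U2) AT ONE POINT, RELATIVE BLOCKING `Lc^m`, POLYNOMIAL CONSTANT**: `FibreStripJMHolds.legBound_jm_of_inv_bound` with `√(cstSqR A η (Lc^m) r₀)`. -/
theorem legBound_jm_of_inv_bound_ratio {η A r0 : ℝ} (hη : 0 ≤ η) (hη4 : η ≤ 1 / 4) (m j : ℕ) {p : Fin 4 → ℂ}
    (him : ∀ i, |(p i).im| ≤ η) (hre : ∀ i, |(p i).re| ≤ π)
    (r : TorusSite 4 (Lc ^ (j + m)) → ℝ) (hr : ∀ n, 0 < r n) (hr4 : ∀ n, n ≠ 0 → 4 ≤ r n ^ 2) (hr0 : 0 < r0) (hr00 : r 0 = r0)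
    (hU : IsUnit (arrowMat (scaledArrow (Lc ^ (j + m)) r r0 p))) (hA : ‖(arrowMat (scaledArrow (Lc ^ (j + m)) r r0 p))⁻¹‖ ≤ A)
    (a b : Fib 3) (zx zy : TorusSite 4 (Lc ^ m)) :
    ‖kFibW (Lc ^ (j + m)) (Lc ^ j) (sfStep Lc j) (smStep 3 Lc j) a (repZ zx) b (repZ zy) p‖ ≤ Real.sqrt (cstSqR A η (Lc ^ m) r0) := by
  have hN : (((Lc ^ (j + m) : ℕ) : ℝ)) = (Lc : ℝ) ^ (j + m) := Nat.cast_pow Lc (j + m)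
  refine norm_kFibW_jm_le_sqrt_cstSqR hη hη4 hr0 m j him hre (sigR (Lc ^ (j + m)) r r0) (rhoR (Lc ^ (j + m)) r r0) (sigR_pos hr hr0)
    (fun n κ => by rw [sigR_A]) (fun κ => by rw [sigR_phi, hN]) (fun κ => ?_) (fun n hn κ => ?_) (fun κ => ?_)
    (apriori_sq_of_inv_bound hr hr0 p hU hA) a b zx zy
  · rw [rhoR_EL, hr00, hN, abs_of_nonneg (by positivity)]
  · rw [rhoR_EL, hN, abs_of_nonneg (by positivity)]
    exact div_le_div_of_nonneg_left (by positivity) (by norm_num) (hr4 n hn)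
  · rw [rhoR_Q, hN, abs_of_nonneg (by positivity)]

end LegBound

/-! ## §2 (I3′) at every relative blocking with one strip half-width and the polynomial constant -/

section Strip

variable {Lc : ℕ} [NeZero Lc]

/-- **(I3′) AT EVERY RELATIVE BLOCKING, ONE STRIP HALF-WIDTH, POLYNOMIAL CONSTANT** [our proof] (`d = 3`, every `Lc ≥ 1`):
`∃ κ, 0 < κ ∧ κ ≤ 1∕4 ∧ ∃ ρ₀, 0 < ρ₀ ∧ ∀ m, StripRegularKM 3 Lc m κ (cstUR (ArrowAnchorReal.aR 4) κ (Lc^m) ρ₀)` — `KPerfTailRate.stripRegularKM_uniform` with §1. -/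
theorem stripRegularKM_uniform_poly :
    ∃ κ : ℝ, 0 < κ ∧ κ ≤ 1 / 4 ∧ ∃ ρ₀ : ℝ, 0 < ρ₀ ∧
      ∀ m : ℕ, StripRegularKM 3 Lc m κ (cstUR (ArrowAnchorReal.aR 4) κ (Lc ^ m) ρ₀) := by
  obtain ⟨cIn, hcIn, hF4⟩ := ArrowInnerShift.exists_cIn 3
  have haZ : (0 : ℝ) ≤ 5 / 2 := by norm_num
  have haR : (0 : ℝ) ≤ ArrowAnchorReal.aR 4 := le_of_lt (ArrowAnchorReal.aR_pos 4)
  have hρ₁ : (0 : ℝ) < 1 / 2 := by norm_num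
  obtain ⟨ρ₀, κ₀, hρ₀, hρ, hsmallIn, hκ₀, hκ, hκη, hsmallOut⟩ :=
    exists_radii (aZ := 5 / 2) (aR := ArrowAnchorReal.aR 4) (cIn := cIn) (cOut := cOut4) (ρ₁ := 1 / 2) (η₁ := 1) OmegaOut haZ haR hcIn
      cOut4_nonneg hρ₁ one_pos OmegaOut_nonneg
  set κ : ℝ := min κ₀ (1 / 4) with hκdef
  have hκpos : 0 < κ := lt_min hκ₀ (by norm_num)
  have hκle : κ ≤ κ₀ := min_le_left _ _
  have hκ4 : κ ≤ 1 / 4 := min_le_right _ _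
  have hmono : ∀ p : Fin (3 + 1) → ℂ, p ∈ Strip (3 + 1) κ → p ∈ Strip (3 + 1) κ₀ := fun p hp μ => ⟨(hp μ).1, (hp μ).2.trans hκle⟩
  refine ⟨κ, hκpos, hκ4, ρ₀, hρ₀, fun m => ?_⟩
  have hF3 : ∀ j : ℕ, IsUnit (arrowMat (innerArrow (Lc ^ (j + m)) (0 : Fin (3 + 1) → ℂ))) ∧
      ‖(arrowMat (innerArrow (Lc ^ (j + m)) (0 : Fin (3 + 1) → ℂ)))⁻¹‖ ≤ 5 / 2 := fun j => isUnit_innerArrow_zero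
  have hF4m : ∀ (j : ℕ) (p : Fin (3 + 1) → ℂ) (r : ℝ), (∀ μ, ‖p μ‖ ≤ r) → r ≤ 1 / 2 →
      ‖arrowMat (innerArrow (Lc ^ (j + m)) p) - arrowMat (innerArrow (Lc ^ (j + m)) 0)‖ ≤ cIn * r :=
    fun j p r hp hr => hF4 (Lc ^ (j + m)) p r hp hr
  have hF5m : ∀ (j : ℕ), ∀ q ∈ BZ (3 + 1), q ≠ 0 → IsUnit (arrowMat (outerArrow (Lc ^ (j + m)) q (ofRealVec q))) ∧
      ‖(arrowMat (outerArrow (Lc ^ (j + m)) q (ofRealVec q)))⁻¹‖ ≤ ArrowAnchorReal.aR 4 :=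
    fun j q hq hq0 => ArrowAnchorReal.arrowAnchorReal (N := Lc ^ (j + m)) (one_le_pow_add j m) (abs_le_pi_of_mem_BZ hq) hq0
  have hF6m : ∀ (j : ℕ), ∀ q ∈ BZ (3 + 1), q ≠ 0 → ∀ p : Fin (3 + 1) → ℂ, reVec p = q → ∀ η : ℝ, 0 ≤ η → η ≤ 1 → (∀ μ, |(p μ).im| ≤ η) →
      ‖arrowMat (outerArrow (Lc ^ (j + m)) q p) - arrowMat (outerArrow (Lc ^ (j + m)) q (ofRealVec q))‖ ≤ cOut4 * η * omegaOut q := by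
    intro j q hq hq0 p hpq η hη0 hη1 him
    have h := ArrowOuterShift.outerLipschitz (D := 4) (N := Lc ^ (j + m)) (one_le_pow_add j m) q hq hq0 p hpq η hη0 hη1 him
    simpa only [cOut4, omegaOut, Nat.cast_ofNat] using h
  have hω : ∀ q ∈ BZ (3 + 1), (∃ μ, ρ₀ / 2 ≤ |q μ|) → omegaOut q ≤ OmegaOut ρ₀ := fun q _ hfar => omegaOut_le hρ₀ q hfar
  have hU1 : ∀ j, ∀ p ∈ Strip (3 + 1) κ₀, (trigPolySymbol (stencil (3 + 1)) (pieceMatrix (N := Lc ^ (j + m))) p).det ≠ 0 := fun j =>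
    det_ne_zero_of_rows (N := Lc ^ (j + m)) omegaOut (hF3 j) (hF4m j) (hF5m j) (hF6m j) hω haZ haR cOut4_nonneg hρ₀ hρ hsmallIn hκ₀.le hκ hκη
      hsmallOut
  have hU2 : ∀ (j : ℕ) (zx zy : TorusSite (3 + 1) (Lc ^ m)) (a b : Fib 3), ∀ p ∈ Strip (3 + 1) κ,
      ‖kFibΔM Lc (sfStep Lc) (smStep 3 Lc) m j a (repZ zx) b (repZ zy) p‖ ≤ cstUR (ArrowAnchorReal.aR 4) κ (Lc ^ m) ρ₀ := by
    intro j zx zy a b p hp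
    have him : ∀ i, |(p i).im| ≤ κ := fun i => (hp i).2
    have hre : ∀ i, |(p i).re| ≤ π := fun i => (hp i).1
    rw [kFibΔM_repZ_eq_kFibW]
    rcases apriori_of_rows (N := Lc ^ (j + m)) omegaOut (hF3 j) (hF4m j) (hF5m j) (hF6m j) hω haZ haR cOut4_nonneg hρ₀ hρ hsmallIn hκ₀.le hκ hκη
        hsmallOut (hmono p hp) with ⟨-, hU, hA⟩ | ⟨hfar, hq0, hU, hA⟩
    · obtain ⟨hr, hr4, hr00⟩ := radI_hyps (N := Lc ^ (j + m))
      exact (legBound_jm_of_inv_bound_ratio hκpos.le hκ4 m j him hre (radI (Lc ^ (j + m))) hr hr4 one_pos hr00 hU hA a b zx zy).trans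
        (le_max_left _ _)
    · have hq : reVec p ∈ BZ (3 + 1) := reVec_mem_BZ hp
      obtain ⟨hr, hr4⟩ := radO_hyps (N := Lc ^ (j + m)) hq hq0
      have h1 := legBound_jm_of_inv_bound_ratio hκpos.le hκ4 m j him hre (radO (Lc ^ (j + m)) (reVec p)) hr hr4 (hr 0) rfl hU hA a b zx zy
      refine h1.trans ((Real.sqrt_le_sqrt ?_).trans (le_max_right _ _))
      have hlo : ρ₀ / π ≤ radO (Lc ^ (j + m)) (reVec p) 0 := le_radO_zero hq hρ₀ hfar
      have hhi : radO (Lc ^ (j + m)) (reVec p) 0 ≤ 2 * π := radO_zero_le hq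
      exact cstSqR_mono (A := 2 * ArrowAnchorReal.aR 4) (η := κ) (R := Lc ^ m) (by positivity) hlo hhi
  refine stripRegularKM_of_repZ fun j zx zy a b => ?_
  exact stripRegular_kFibΔM hκpos.le _ _ m j (fun p hp => hU1 j p (hmono p hp)) a (repZ zx) b (repZ zy) (hU2 j zx zy a b)

end Strip

/-! ## §3 The polynomial majorant `cstUR aR κ R ρ₀ ≤ KU aR κ ρ₀ · R⁶` -/

section Poly

/-- [our object] `R`-free majorant of `cstSqR A η R r₀ ∕ R¹²`. -/
def polySq (A η r₀ : ℝ) : ℝ :=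
  A ^ 2 * (Real.exp (η * 4) ^ 4 * ((6 : ℝ) ^ 10 * (5 : ℝ) ^ 4) * (r₀⁻¹ ^ 4 + 39) + Real.exp (η * 4) ^ 2 * ((6 : ℝ) ^ 5 * (5 : ℝ) ^ 4)
    + Real.exp (η * 4) ^ 2 * (6 : ℝ) ^ 5 * (1 + 39 * r₀ ^ 4) + r₀ ^ 4)

/-- [our object] `R`-free majorant of `envOutR aR κ R ρ₀ ∕ R¹²`. -/
def polyOut (aR κ ρ₀ : ℝ) : ℝ :=
  (2 * aR) ^ 2 * (Real.exp (κ * 4) ^ 4 * ((6 : ℝ) ^ 10 * (5 : ℝ) ^ 4) * ((ρ₀ / π)⁻¹ ^ 4 + 39) + Real.exp (κ * 4) ^ 2 * ((6 : ℝ) ^ 5 * (5 : ℝ) ^ 4)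
    + Real.exp (κ * 4) ^ 2 * (6 : ℝ) ^ 5 * (1 + 39 * (2 * π) ^ 4) + (2 * π) ^ 4)

/-- [our object] THE `R`-FREE AMPLITUDE CONSTANT: `KU aR κ ρ₀ := max √(polySq 5 κ 1) √(polyOut aR κ ρ₀)`. -/
def KU (aR κ ρ₀ : ℝ) : ℝ := max (Real.sqrt (polySq (2 * (5 / 2)) κ 1)) (Real.sqrt (polyOut aR κ ρ₀))

/-- [folklore] `0 ≤ KU`. -/
theorem KU_nonneg (aR κ ρ₀ : ℝ) : 0 ≤ KU aR κ ρ₀ := le_max_of_le_left (Real.sqrt_nonneg _)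

/-- [folklore] For `1 ≤ R`: `R⁻² ≤ R¹²` and `R⁻¹⁶ ≤ R¹²`. -/
theorem inv_pow_le_pow12 {R : ℕ} (hR : 1 ≤ R) (k : ℕ) : ((R : ℝ) ^ k)⁻¹ ≤ (R : ℝ) ^ 12 := by
  have hR' : (1 : ℝ) ≤ R := by exact_mod_cast hR
  exact (inv_le_one_of_one_le₀ (one_le_pow₀ hR')).trans (one_le_pow₀ hR')

/-- [folklore] **`cstSqR A η R r₀ ≤ polySq A η r₀ · R¹²`** for `1 ≤ R`. -/
theorem cstSqR_le_polySq_mul {A η r₀ : ℝ} {R : ℕ} (hR : 1 ≤ R) : cstSqR A η R r₀ ≤ polySq A η r₀ * (R : ℝ) ^ 12 := by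
  have h2 := inv_pow_le_pow12 hR 2
  have h16 := inv_pow_le_pow12 hR 16
  have e1 : 0 ≤ Real.exp (η * 4) ^ 4 * ((6 : ℝ) ^ 10 * (5 : ℝ) ^ 4) * (r₀⁻¹ ^ 4 + 39) := by positivity
  have e2 : 0 ≤ Real.exp (η * 4) ^ 2 * ((6 : ℝ) ^ 5 * (5 : ℝ) ^ 4) := by positivity
  have e3 : 0 ≤ Real.exp (η * 4) ^ 2 * (6 : ℝ) ^ 5 * (1 + 39 * r₀ ^ 4) := by positivity
  have e4 : 0 ≤ r₀ ^ 4 := by positivity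
  have key : Real.exp (η * 4) ^ 4 * ((6 : ℝ) ^ 10 * (5 : ℝ) ^ 4 * (R : ℝ) ^ 12) * (r₀⁻¹ ^ 4 + 39)
      + Real.exp (η * 4) ^ 2 * ((6 : ℝ) ^ 5 * (5 : ℝ) ^ 4) * ((R : ℝ) ^ 2)⁻¹
      + Real.exp (η * 4) ^ 2 * (6 : ℝ) ^ 5 * (1 + 39 * r₀ ^ 4) * ((R : ℝ) ^ 2)⁻¹
      + r₀ ^ 4 * ((R : ℝ) ^ 16)⁻¹ ≤
      (Real.exp (η * 4) ^ 4 * ((6 : ℝ) ^ 10 * (5 : ℝ) ^ 4) * (r₀⁻¹ ^ 4 + 39) + Real.exp (η * 4) ^ 2 * ((6 : ℝ) ^ 5 * (5 : ℝ) ^ 4)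
        + Real.exp (η * 4) ^ 2 * (6 : ℝ) ^ 5 * (1 + 39 * r₀ ^ 4) + r₀ ^ 4) * (R : ℝ) ^ 12 := by
    have t1 : Real.exp (η * 4) ^ 4 * ((6 : ℝ) ^ 10 * (5 : ℝ) ^ 4 * (R : ℝ) ^ 12) * (r₀⁻¹ ^ 4 + 39) =
        (Real.exp (η * 4) ^ 4 * ((6 : ℝ) ^ 10 * (5 : ℝ) ^ 4) * (r₀⁻¹ ^ 4 + 39)) * (R : ℝ) ^ 12 := by ring
    have t2 := mul_le_mul_of_nonneg_left h2 e2
    have t3 := mul_le_mul_of_nonneg_left h2 e3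
    have t4 := mul_le_mul_of_nonneg_left h16 e4
    nlinarith [t1, t2, t3, t4]
  unfold cstSqR polySq
  exact le_of_le_of_eq (mul_le_mul_of_nonneg_left key (sq_nonneg A)) (by ring)

/-- [folklore] **`envOutR aR κ R ρ₀ ≤ polyOut aR κ ρ₀ · R¹²`** for `1 ≤ R` (`envOutR = cstSqR`-shape at `A = 2aR` with the two radius slots `ρ₀∕π`, `2π`). -/
theorem envOutR_le_polyOut_mul {aR κ ρ₀ : ℝ} {R : ℕ} (hR : 1 ≤ R) : envOutR aR κ R ρ₀ ≤ polyOut aR κ ρ₀ * (R : ℝ) ^ 12 := by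
  have h2 := inv_pow_le_pow12 hR 2
  have h16 := inv_pow_le_pow12 hR 16
  have e2 : 0 ≤ Real.exp (κ * 4) ^ 2 * ((6 : ℝ) ^ 5 * (5 : ℝ) ^ 4) := by positivity
  have e3 : 0 ≤ Real.exp (κ * 4) ^ 2 * (6 : ℝ) ^ 5 * (1 + 39 * (2 * π) ^ 4) := by positivity
  have e4 : 0 ≤ (2 * π) ^ 4 := by positivity
  have key : Real.exp (κ * 4) ^ 4 * ((6 : ℝ) ^ 10 * (5 : ℝ) ^ 4 * (R : ℝ) ^ 12) * ((ρ₀ / π)⁻¹ ^ 4 + 39)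
      + Real.exp (κ * 4) ^ 2 * ((6 : ℝ) ^ 5 * (5 : ℝ) ^ 4) * ((R : ℝ) ^ 2)⁻¹
      + Real.exp (κ * 4) ^ 2 * (6 : ℝ) ^ 5 * (1 + 39 * (2 * π) ^ 4) * ((R : ℝ) ^ 2)⁻¹
      + (2 * π) ^ 4 * ((R : ℝ) ^ 16)⁻¹ ≤
      (Real.exp (κ * 4) ^ 4 * ((6 : ℝ) ^ 10 * (5 : ℝ) ^ 4) * ((ρ₀ / π)⁻¹ ^ 4 + 39) + Real.exp (κ * 4) ^ 2 * ((6 : ℝ) ^ 5 * (5 : ℝ) ^ 4)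
        + Real.exp (κ * 4) ^ 2 * (6 : ℝ) ^ 5 * (1 + 39 * (2 * π) ^ 4) + (2 * π) ^ 4) * (R : ℝ) ^ 12 := by
    have t1 : Real.exp (κ * 4) ^ 4 * ((6 : ℝ) ^ 10 * (5 : ℝ) ^ 4 * (R : ℝ) ^ 12) * ((ρ₀ / π)⁻¹ ^ 4 + 39) =
        (Real.exp (κ * 4) ^ 4 * ((6 : ℝ) ^ 10 * (5 : ℝ) ^ 4) * ((ρ₀ / π)⁻¹ ^ 4 + 39)) * (R : ℝ) ^ 12 := by ring
    have t2 := mul_le_mul_of_nonneg_left h2 e2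
    have t3 := mul_le_mul_of_nonneg_left h2 e3
    have t4 := mul_le_mul_of_nonneg_left h16 e4
    nlinarith [t1, t2, t3, t4]
  unfold envOutR polyOut
  exact le_of_le_of_eq (mul_le_mul_of_nonneg_left key (sq_nonneg (2 * aR))) (by ring)

/-- [folklore] `√(P·R¹²) = √P·R⁶` for `0 ≤ P`-free statement: `√(P·R¹²) ≤ √P·R⁶`. -/
theorem sqrt_mul_pow12_le (P : ℝ) (R : ℕ) : Real.sqrt (P * (R : ℝ) ^ 12) ≤ Real.sqrt P * (R : ℝ) ^ 6 := by
  have hR : (0 : ℝ) ≤ (R : ℝ) ^ 6 := by positivity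
  have h12 : ((R : ℝ) ^ 12) = ((R : ℝ) ^ 6) ^ 2 := by ring
  rw [h12, Real.sqrt_mul' _ (sq_nonneg _), Real.sqrt_sq hR]

/-- **THE POLYNOMIAL MAJORANT** [our proof]: `1 ≤ R → cstUR aR κ R ρ₀ ≤ KU aR κ ρ₀ · R⁶`. -/
theorem cstUR_le_KU_mul_pow {aR κ ρ₀ : ℝ} {R : ℕ} (hR : 1 ≤ R) : cstUR aR κ R ρ₀ ≤ KU aR κ ρ₀ * (R : ℝ) ^ 6 := by
  have hR6 : (0 : ℝ) ≤ (R : ℝ) ^ 6 := by positivity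
  unfold cstUR KU
  refine max_le ?_ ?_
  · calc Real.sqrt (cstSqR (2 * (5 / 2)) κ R 1) ≤ Real.sqrt (polySq (2 * (5 / 2)) κ 1 * (R : ℝ) ^ 12) :=
          Real.sqrt_le_sqrt (cstSqR_le_polySq_mul hR)
      _ ≤ Real.sqrt (polySq (2 * (5 / 2)) κ 1) * (R : ℝ) ^ 6 := sqrt_mul_pow12_le _ _
      _ ≤ max (Real.sqrt (polySq (2 * (5 / 2)) κ 1)) (Real.sqrt (polyOut aR κ ρ₀)) * (R : ℝ) ^ 6 :=
          mul_le_mul_of_nonneg_right (le_max_left _ _) hR6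
  · calc Real.sqrt (envOutR aR κ R ρ₀) ≤ Real.sqrt (polyOut aR κ ρ₀ * (R : ℝ) ^ 12) :=
          Real.sqrt_le_sqrt (envOutR_le_polyOut_mul hR)
      _ ≤ Real.sqrt (polyOut aR κ ρ₀) * (R : ℝ) ^ 6 := sqrt_mul_pow12_le _ _
      _ ≤ max (Real.sqrt (polySq (2 * (5 / 2)) κ 1)) (Real.sqrt (polyOut aR κ ρ₀)) * (R : ℝ) ^ 6 :=
          mul_le_mul_of_nonneg_right (le_max_right _ _) hR6

end Poly

/-! ## §4 The perfect one-step resolvent: polynomial amplitude, rate `δ₀ ∕ n` -/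

section Main

variable {Lc : ℕ} [NeZero Lc]

/-- **THE `j`-UNIFORM DECAY OF THE (j, m)-RESOLVENTS WITH POLYNOMIAL AMPLITUDE AND RATE `δ₀ ∕ Lc^m`, BOTH CONSTANTS FREE OF `m`** [our proof] (`d = 3`, every
`Lc ≥ 1`): `∃ δ₀ C₀, 0 < δ₀ ∧ 0 ≤ C₀ ∧ ∀ m j, Decays (unitK (sfStep Lc j) (smStep 3 Lc j) (KTot (Lc^(j+m)) (Lc^j))) (C₀·((Lc:ℝ)^m)^6) (δ₀ ∕ (Lc:ℝ)^m)`. -/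
theorem decays_KTot_polyAmplitude : ∃ δ₀ C₀ : ℝ, 0 < δ₀ ∧ 0 ≤ C₀ ∧
    ∀ m j : ℕ, Decays (unitK (sfStep Lc j) (smStep 3 Lc j) (KTot (d := 3) (Lc ^ (j + m)) (Lc ^ j))) (C₀ * ((Lc : ℝ) ^ m) ^ 6) (δ₀ / (Lc : ℝ) ^ m) := by
  obtain ⟨κ, hκ, -, ρ₀, -, h⟩ := stripRegularKM_uniform_poly (Lc := Lc)
  refine ⟨κ / (3 + 1), KU (ArrowAnchorReal.aR 4) κ ρ₀ * Real.exp (2 * κ), by positivity,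
    mul_nonneg (KU_nonneg _ _ _) (Real.exp_pos _).le, fun m j => ?_⟩
  have hU := uniformDecays_of_stripRegularKM hκ.le (h m) j
  have hC0 : 0 ≤ cstUR (ArrowAnchorReal.aR 4) κ (Lc ^ m) ρ₀ * Real.exp (2 * κ) := mul_nonneg (cstUR_nonneg _ _ _ _) (Real.exp_pos _).le
  have hCle : cstUR (ArrowAnchorReal.aR 4) κ (Lc ^ m) ρ₀ * Real.exp (2 * κ) ≤ KU (ArrowAnchorReal.aR 4) κ ρ₀ * Real.exp (2 * κ) * ((Lc : ℝ) ^ m) ^ 6 := by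
    have h1 := cstUR_le_KU_mul_pow (aR := ArrowAnchorReal.aR 4) (κ := κ) (ρ₀ := ρ₀) (BalabanStepJetsSucc.one_le_pow_Lc (Lc := Lc) m)
    rw [Nat.cast_pow] at h1
    calc cstUR (ArrowAnchorReal.aR 4) κ (Lc ^ m) ρ₀ * Real.exp (2 * κ) ≤ KU (ArrowAnchorReal.aR 4) κ ρ₀ * ((Lc : ℝ) ^ m) ^ 6 * Real.exp (2 * κ) :=
          mul_le_mul_of_nonneg_right h1 (Real.exp_pos _).le
      _ = KU (ArrowAnchorReal.aR 4) κ ρ₀ * Real.exp (2 * κ) * ((Lc : ℝ) ^ m) ^ 6 := by ring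
  have hD : Decays (unitK (sfStep Lc j) (smStep 3 Lc j) (KTot (d := 3) (Lc ^ (j + m)) (Lc ^ j)))
      (cstUR (ArrowAnchorReal.aR 4) κ (Lc ^ m) ρ₀ * Real.exp (2 * κ)) (κ / (3 + 1) / (Lc : ℝ) ^ m) := by
    rw [div_div]
    simpa only [Nat.cast_ofNat] using hU
  exact decays_mono hD hC0 hCle le_rfl

/-- **THE PERFECT ONE-STEP RESOLVENT AT BASE `n = Lc^m`: POLYNOMIAL AMPLITUDE `C₀·n⁶`, RATE `δ₀ ∕ n`, `δ₀` AND `C₀` INDEPENDENT OF `m`** [our proof] (`d = 3`, `2 ≤ Lc`,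
every `m ≥ 1`): `∃ δ₀ C₀, 0 < δ₀ ∧ 0 ≤ C₀ ∧ ∀ m ≥ 1, Decays (KPerf Lc (sfStep Lc) (smStep 3 Lc) m) (C₀·((Lc:ℝ)^m)^6) (δ₀ ∕ (Lc:ℝ)^m)` —
`KSlotJMHolds.decays_KPerf_explicit` (X1m-K BY NAME) on §2, then §3. -/
theorem decays_KPerf_polyAmplitude (hLc : 2 ≤ Lc) : ∃ δ₀ C₀ : ℝ, 0 < δ₀ ∧ 0 ≤ C₀ ∧
    ∀ m : ℕ, 1 ≤ m → Decays (KPerf (d := 3) Lc (sfStep Lc) (smStep 3 Lc) m) (C₀ * ((Lc : ℝ) ^ m) ^ 6) (δ₀ / (Lc : ℝ) ^ m) := by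
  obtain ⟨κ, hκ, -, ρ₀, -, h⟩ := stripRegularKM_uniform_poly (Lc := Lc)
  refine ⟨κ / (3 + 1), KU (ArrowAnchorReal.aR 4) κ ρ₀ * Real.exp (2 * κ), by positivity,
    mul_nonneg (KU_nonneg _ _ _) (Real.exp_pos _).le, fun m hm => ?_⟩
  have hD0 := decays_KPerf_explicit hLc hm hκ.le (h m)
  have hC0 : 0 ≤ cstUR (ArrowAnchorReal.aR 4) κ (Lc ^ m) ρ₀ * Real.exp (2 * κ) := mul_nonneg (cstUR_nonneg _ _ _ _) (Real.exp_pos _).le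
  have hCle : cstUR (ArrowAnchorReal.aR 4) κ (Lc ^ m) ρ₀ * Real.exp (2 * κ) ≤ KU (ArrowAnchorReal.aR 4) κ ρ₀ * Real.exp (2 * κ) * ((Lc : ℝ) ^ m) ^ 6 := by
    have h1 := cstUR_le_KU_mul_pow (aR := ArrowAnchorReal.aR 4) (κ := κ) (ρ₀ := ρ₀) (BalabanStepJetsSucc.one_le_pow_Lc (Lc := Lc) m)
    rw [Nat.cast_pow] at h1
    calc cstUR (ArrowAnchorReal.aR 4) κ (Lc ^ m) ρ₀ * Real.exp (2 * κ) ≤ KU (ArrowAnchorReal.aR 4) κ ρ₀ * ((Lc : ℝ) ^ m) ^ 6 * Real.exp (2 * κ) :=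
          mul_le_mul_of_nonneg_right h1 (Real.exp_pos _).le
      _ = KU (ArrowAnchorReal.aR 4) κ ρ₀ * Real.exp (2 * κ) * ((Lc : ℝ) ^ m) ^ 6 := by ring
  have hD : Decays (KPerf (d := 3) Lc (sfStep Lc) (smStep 3 Lc) m) (cstUR (ArrowAnchorReal.aR 4) κ (Lc ^ m) ρ₀ * Real.exp (2 * κ))
      (κ / (3 + 1) / (Lc : ℝ) ^ m) := by
    rw [div_div]
    simpa only [Nat.cast_ofNat] using hD0
  exact decays_mono hD hC0 hCle le_rfl

/-- [our proof] **`n`-INDEXED POINTWISE READING** (`n := Lc^m` cast to `ℝ`): `|KPerf … m x′ y′ a b| ≤ C₀·n⁶·exp(−(δ₀∕n)·|x′ − y′|₁)`, one `(δ₀, C₀)` for all `m ≥ 1`. -/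
theorem abs_KPerf_le_polyAmplitude (hLc : 2 ≤ Lc) : ∃ δ₀ C₀ : ℝ, 0 < δ₀ ∧ 0 ≤ C₀ ∧
    ∀ m : ℕ, 1 ≤ m → ∀ (x' y' : Fin (3 + 1) → ℤ) (a b : Fib 3),
      |KPerf (d := 3) Lc (sfStep Lc) (smStep 3 Lc) m x' y' a b| ≤
        C₀ * ((Lc ^ m : ℕ) : ℝ) ^ 6 * Real.exp (-(δ₀ / ((Lc ^ m : ℕ) : ℝ)) * B12Sec2to5.l1 (x' - y')) := by
  obtain ⟨δ₀, C₀, hδ₀, hC₀, h⟩ := decays_KPerf_polyAmplitude (Lc := Lc) hLc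
  refine ⟨δ₀, C₀, hδ₀, hC₀, fun m hm x' y' a b => ?_⟩
  rw [Nat.cast_pow]
  exact h m hm x' y' a b

end Main

end Summit.QuantumFields.BalabanUV.Beta.GAN24.KPerfTailAmplitude

end
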